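import Summits.BirchSwinnertonDyer.BirchSwinnertonDyer.Theorems.GenusKolyvaginAtTwoPowDvdShaCardAtTwoRTLadderFrame
import Literature.NumberTheory.EllipticCurves.SelmerImage
import Literature.NumberTheory.EllipticCurves.SelmerTorsionRestriction
import Literature.Barriers.BirchSwinnertonDyer.DescentDefectUnboundedMatsunoCor33Proofs
import HarnessLib

/-!
# Route `GenusKolyvaginAtTwo`, LINE 18 (L_T `PowDvdShaCardAtTwoRT`, stmt-BirchSwinnertonDyer-23242), THE crux 3a⁗ — the pen's
# «A-ASSEMBLY LEMMA» (v4.5 answer to the LEAD): exhibited subgroups `T₊ ≤ Sel^rel_{2^N}(W/ℚ)`, `T₋ ≤ Sel^rel_{2^N}(Wd/ℚ)` off the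
# Kummer lines, of even `2`-adic size, with `2M₀ ≤ ord₂ #T₊ + ord₂ #T₋`, and `ord₂ C(Wd) ≤ 1` ⊢ `2M₀ ≤ ord₂ g + ord₂ g′`

Seat `bsd-line-gk2-p3` g18 (cell `bsd-f1-sign2`), `--supports stmt-BirchSwinnertonDyer-23242` (helper; closes nothing).
THEOREMS ONLY (no definition, no named fact, no `sorry`); BSD is not proved by any of this.

This is the SELMER-currency interface of the Shallow regime (`stub_twinExhibitionGenusShallow`, pen v4.5), kernel-checked on top of
this seat's `Ш`-level budgets (`…RTRelaxedShaGenusBudget`, `…RTLadderFrame`) and index transfer (`…RTLadderFrameBookkeeping`):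
* §1 `natCard_dvd_natCard_primaryComponent_comap_sha_of_le_comap_selmerGroup` — for `X/ℚ`, a level `2^N` and a subgroup
  `T ≤ res⁻¹(Sel_{2^N}(X_K/K)) ≤ H¹(ℚ, X[2^N])` DISJOINT from `ker(H¹(ℚ, X[2^N]) → H¹(ℚ, X))` (the Kummer image of `X(ℚ)`):
  `#T ∣ #(res⁻¹(Ш(X_K/K)))[2^∞]` (`Sel = comap Ш`, naturality `torsionH1ToH1_resTorsion`, classes killed by `2^N`);
  `padicValNat_natCard_le_of_le_comap_selmerGroup` — hence `ord₂ #T ≤ ord₂ #Ш(X/ℚ)[2^∞] + B` whenever `[res⁻¹Ш(X_K) : Ш(X)] ≤ 2^B`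
  is finite, and `ord₂ #T ≤ ord₂ #Ш(X/ℚ)[2^∞]` if moreover `ord₂ #T` is even and `B ≤ 1` (Cassels–Tate parity).
* §2 **`twinExhibitionGenus_ineq_of_exhibited_selmer_subgroups`** — on the LINE 18 frame (`Δ<0`, `C(W)` odd, Heegner `K`, `d_K` odd,
  `Wd = Cd • W^{(d_K)}`), subgroups `T₊`, `T₋` as above (levels `2^N`, `2^N′`), `Even (ord₂ #T₊)`, `Even (ord₂ #T₋)`,
  `2·M₀ ≤ ord₂ #T₊ + ord₂ #T₋`, `ord₂ C(Wd) ≤ 1` ⊢ `2·M₀ ≤ ord₂ g + ord₂ g′` (hence 3a⁗'s `+ ord₂ C(Wd)`; 3a‴'s `− 1` via `stub_genusParity`).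
It fixes what the ladder (gk2-p2's (c), the LEAD's rungs) must deliver in Selmer currency and closes the Shallow regime the moment it does.

References: [McCallumLMS1991] §5 Thm. 5.4; [Kramer1981] §2 Prop. 3, Thm. 1; [SilvermanAEC2009] X.§4 (Sel and Ш), X.4.14.
-/

set_option autoImplicit false
-- the Theorems namespace of this sub repeats the summit name by design (D-0017 nested layout)
set_option linter.dupNamespace false

noncomputable section

open scoped Classical

namespace Summit.BirchSwinnertonDyer.BirchSwinnertonDyer.Theorems.GenusExact.PlusDescent

open WeierstrassCurve NumberField IsDedekindDomain Rat.HeightOneSpectrum Literature.NumberTheory.EllipticCurves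
  Literature.Barriers.BirchSwinnertonDyer

/-! ## §1 One side: an exhibited Selmer-currency subgroup is no bigger than `2^B · #Ш(X/ℚ)[2^∞]` -/

section OneSide

variable (K : Type) [Field K] [NumberField K] (X : WeierstrassCurve ℚ) [X.IsElliptic]

omit [X.IsElliptic] in
/-- **`#T ∣ #(res⁻¹(Ш(X_K/K)))[2^∞]`** for `T ≤ res⁻¹(Sel_{2^N}(X_K/K)) ≤ H¹(ℚ, X[2^N])` disjoint from the kernel of
`H¹(ℚ, X[2^N]) → H¹(ℚ, X)` (the Kummer image): the map is injective on `T`, lands in `res⁻¹(Ш(X_K/K))`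
(`selmerGroup_eq_comap_sha`, `torsionH1ToH1_resTorsion`), and its image is `2^N`-torsion. [cite: SilvermanAEC2009, X.§4] -/
theorem natCard_dvd_natCard_primaryComponent_comap_sha_of_le_comap_selmerGroup (N : ℕ)
    (T : AddSubgroup (galH1Torsion X ((2 ^ N : ℕ) : ℤ)))
    (hT : T ≤ (selmerGroup (X.baseChange K) ((2 ^ N : ℕ) : ℤ)).comap (resTorsion X K ((2 ^ N : ℕ) : ℤ)))
    (hker : Disjoint T (torsionH1ToH1 X ((2 ^ N : ℕ) : ℤ)).ker) :
    Nat.card T ∣ Nat.card (AddCommGroup.primaryComponent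
      ↥(((X.baseChange K).sha).comap (resBaseChange X K)) 2) := by
  set R : AddSubgroup X.galH1 := ((X.baseChange K).sha).comap (resBaseChange X K) with hR
  let f : galH1Torsion X ((2 ^ N : ℕ) : ℤ) →+ X.galH1 := torsionH1ToH1 X ((2 ^ N : ℕ) : ℤ)
  -- the image of `T` lies in `R`
  have hmemR : ∀ t ∈ T, f t ∈ R := fun t ht ↦ by
    have h := hT ht
    rw [AddSubgroup.mem_comap, selmerGroup_eq_comap_sha, AddSubgroup.mem_comap, torsionH1ToH1_resTorsion] at h
    exact AddSubgroup.mem_comap.mpr h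
  -- and is `2^N`-torsion
  have htor : ∀ t ∈ T, 2 ^ N • f t = 0 := fun t _ ↦ by
    rw [← map_nsmul, ← natCast_zsmul]
    have : ((2 ^ N : ℕ) : ℤ) • t = 0 := zsmul_galH1Torsion_eq_zero X ((2 ^ N : ℕ) : ℤ) t
    rw [this, map_zero]
  -- the injective hom `T → R[2^∞]`
  let g : T →+ AddCommGroup.primaryComponent R 2 :=
    { toFun := fun t ↦ ⟨⟨f t, hmemR t t.2⟩, (AddCommGroup.mem_primaryComponent).mpr ⟨N, Subtype.ext (by
          simpa using htor t t.2)⟩⟩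
      map_zero' := by
        apply Subtype.ext; apply Subtype.ext
        simp only [ZeroMemClass.coe_zero, map_zero]
      map_add' := fun s t ↦ by
        apply Subtype.ext; apply Subtype.ext
        simp only [AddSubgroup.coe_add, map_add] }
  have hgval : ∀ t : T, (((g t : AddCommGroup.primaryComponent R 2) : R) : X.galH1) = f t := fun _ ↦ rfl
  have hg : Function.Injective g := by
    refine (injective_iff_map_eq_zero g).mpr fun t ht ↦ ?_
    have h0 : f t = 0 := by
      rw [← hgval t, ht]
      rfl
    have hmem : (t : galH1Torsion X ((2 ^ N : ℕ) : ℤ)) ∈ T ⊓ (torsionH1ToH1 X ((2 ^ N : ℕ) : ℤ)).ker :=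
      AddSubgroup.mem_inf.mpr ⟨t.2, (AddMonoidHom.mem_ker).mpr h0⟩
    rw [hker.eq_bot, AddSubgroup.mem_bot] at hmem
    exact Subtype.ext hmem
  have hcard : Nat.card T = Nat.card g.range := Nat.card_congr (AddMonoidHom.ofInjective hg).toEquiv
  rw [hcard]
  exact AddSubgroup.card_addSubgroup_dvd_card g.range

/-- **`ord₂ #T ≤ ord₂ #Ш(X/ℚ)[2^∞] + B`** for such a `T`, when `Ш(X/ℚ)[2^∞]` is finite and `[res⁻¹(Ш(X_K/K)) : Ш(X/ℚ)] ≤ 2^B` is finite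
(index transfer `exists_natCard_primaryComponent_eq_mul_of_le`); and **`ord₂ #T ≤ ord₂ #Ш(X/ℚ)[2^∞]`** if moreover `ord₂ #T` is even and
`B ≤ 1` (Cassels–Tate: `ord₂ #Ш(X/ℚ)[2^∞]` is even). [cite: SilvermanAEC2009, X.4.14] [cite: Kramer1981, §2 Prop. 3] -/
theorem padicValNat_natCard_le_of_le_comap_selmerGroup (N : ℕ) {B : ℕ}
    (T : AddSubgroup (galH1Torsion X ((2 ^ N : ℕ) : ℤ)))
    (hT : T ≤ (selmerGroup (X.baseChange K) ((2 ^ N : ℕ) : ℤ)).comap (resTorsion X K ((2 ^ N : ℕ) : ℤ)))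
    (hker : Disjoint T (torsionH1ToH1 X ((2 ^ N : ℕ) : ℤ)).ker)
    (hg : 0 < Nat.card (AddCommGroup.primaryComponent X.sha 2))
    (hidx : (X.sha).relIndex (((X.baseChange K).sha).comap (resBaseChange X K)) ≠ 0)
    (hle : (X.sha).relIndex (((X.baseChange K).sha).comap (resBaseChange X K)) ≤ 2 ^ B) :
    padicValNat 2 (Nat.card T) ≤ padicValNat 2 (Nat.card (AddCommGroup.primaryComponent X.sha 2)) + B ∧
      (Even (padicValNat 2 (Nat.card T)) → B ≤ 1 →
        padicValNat 2 (Nat.card T) ≤ padicValNat 2 (Nat.card (AddCommGroup.primaryComponent X.sha 2))) := by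
  set R : AddSubgroup X.galH1 := ((X.baseChange K).sha).comap (resBaseChange X K) with hR
  have hHR : X.sha ≤ R := fun c hc ↦ AddSubgroup.mem_comap.mpr (resBaseChange_mem_sha X K hc)
  haveI : Finite (AddCommGroup.primaryComponent X.sha 2) := Nat.finite_of_card_ne_zero hg.ne'
  obtain ⟨k, hk, hkdvd, hcard⟩ := exists_natCard_primaryComponent_eq_mul_of_le hHR 2 hidx
  have hkB : k ≤ 2 ^ B := (Nat.le_of_dvd (Nat.pos_of_ne_zero hidx) hkdvd).trans hle
  have hdvd := natCard_dvd_natCard_primaryComponent_comap_sha_of_le_comap_selmerGroup K X N T hT hker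
  rw [hcard] at hdvd
  have hne : k * Nat.card (AddCommGroup.primaryComponent X.sha 2) ≠ 0 := mul_ne_zero hk.ne' hg.ne'
  have hT0 : Nat.card T ≠ 0 := fun h ↦ hne (Nat.eq_zero_of_zero_dvd (h ▸ hdvd))
  have h1 := (padicValNat_dvd_iff_le hne).mp ((pow_padicValNat_dvd (p := 2) (n := Nat.card T)).trans hdvd)
  rw [padicValNat.mul hk.ne' hg.ne'] at h1
  have hvk : padicValNat 2 k ≤ B := by
    have h2 : 2 ^ padicValNat 2 k ≤ k := Nat.le_of_dvd hk pow_padicValNat_dvd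
    exact (Nat.pow_le_pow_iff_right (by norm_num)).mp (h2.trans hkB)
  have heven : Even (padicValNat 2 (Nat.card (AddCommGroup.primaryComponent X.sha 2))) :=
    even_padicValNat_of_isSquare hg.ne' (CasselsTateNumberField.isSquare_natCard_primaryComponent_sha X 2)
  refine ⟨by omega, fun hTeven hB ↦ ?_⟩
  obtain ⟨u, hu⟩ := hTeven
  obtain ⟨v, hv⟩ := heven
  omega

end OneSide

/-! ## §2 The A-assembly on the LINE 18 frame -/

section Assembly

variable (W : WeierstrassCurve ℚ) [W.IsElliptic] [W.IsGloballyMinimal] (K : Type) [Field K] [NumberField K]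
  {Wd : WeierstrassCurve ℚ} [Wd.IsElliptic]

/-- **THE A-ASSEMBLY LEMMA (pen v4.5, Shallow regime of THE crux 3a⁗).**  On the LINE 18 frame — `W/ℚ` globally minimal elliptic,
`Δ_W < 0`, `C(W)` odd; `K` imaginary quadratic, `d_K` odd, Heegner for `N_W`; `Wd = Cd • W^{(d_K)}` elliptic; `Ш(W/ℚ)[2^∞]`,
`Ш(Wd/ℚ)[2^∞]` finite (orders `g, g′`) — let `T₊ ≤ res⁻¹(Sel_{2^N}(W_K/K)) ≤ H¹(ℚ, W[2^N])` and `T₋ ≤ res⁻¹(Sel_{2^{N′}}(Wd_K/K))` be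
subgroups disjoint from the Kummer kernels (`ker(H¹(ℚ, ·[2^N]) → H¹(ℚ, ·))`; for the rank-`0` member this is automatic, for the rank-`1`
member it is McCallum's «`⟨c⟩ ∩ ⟨c_M(1)⟩ = 0`»), with `ord₂ #T₊`, `ord₂ #T₋` EVEN (Kolyvagin pairs) and `2·M₀ ≤ ord₂ #T₊ + ord₂ #T₋`.
If `ord₂ C(Wd) ≤ 1` then `2·M₀ ≤ ord₂ g + ord₂ g′` (so 3a⁗ `… + ord₂ C(Wd)`, second conjunct; 3a‴'s `… + ord₂ C(Wd) − 1` then follows from the genus parity `stub_genusParity`, `B` odd on `Δ<0`).  Proof: per side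
`ord₂ #T ≤ ord₂ g + B` (§1 with this seat's `Ш`-level budgets, `B = ord₂ C(Wd)` on both sides), Cassels–Tate evenness repays the bit.
[cite: McCallumLMS1991, §5 Thm. 5.4] [cite: Kramer1981, §2 Prop. 3 and Thm. 1] [cite: SilvermanAEC2009, X.4.14] -/
theorem twinExhibitionGenus_ineq_of_exhibited_selmer_subgroups (hΔ : W.Δ < 0) (hT : Odd W.tamagawaProduct)
    (hIQ : IsImaginaryQuadratic K) (hodd : Odd (NumberField.discr K)) (hHe : SatisfiesHeegnerHypothesis (W.conductorNorm ℤ) K)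
    (Cd : VariableChange ℚ) (hWd : Cd • W.quadraticTwist (NumberField.discr K : ℚ) = Wd)
    (hB : padicValNat 2 Wd.tamagawaProduct ≤ 1)
    (hg : 0 < Nat.card (AddCommGroup.primaryComponent W.sha 2)) (hg' : 0 < Nat.card (AddCommGroup.primaryComponent Wd.sha 2))
    {M₀ N N' : ℕ} (Tp : AddSubgroup (galH1Torsion W ((2 ^ N : ℕ) : ℤ)))
    (hTp : Tp ≤ (selmerGroup (W.baseChange K) ((2 ^ N : ℕ) : ℤ)).comap (resTorsion W K ((2 ^ N : ℕ) : ℤ)))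
    (hTpker : Disjoint Tp (torsionH1ToH1 W ((2 ^ N : ℕ) : ℤ)).ker)
    (Tm : AddSubgroup (galH1Torsion Wd ((2 ^ N' : ℕ) : ℤ)))
    (hTm : Tm ≤ (selmerGroup (Wd.baseChange K) ((2 ^ N' : ℕ) : ℤ)).comap (resTorsion Wd K ((2 ^ N' : ℕ) : ℤ)))
    (hTmker : Disjoint Tm (torsionH1ToH1 Wd ((2 ^ N' : ℕ) : ℤ)).ker)
    (hevp : Even (padicValNat 2 (Nat.card Tp))) (hevm : Even (padicValNat 2 (Nat.card Tm)))
    (hsum : 2 * M₀ ≤ padicValNat 2 (Nat.card Tp) + padicValNat 2 (Nat.card Tm)) :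
    2 * M₀ ≤ padicValNat 2 (Nat.card (AddCommGroup.primaryComponent W.sha 2)) +
      padicValNat 2 (Nat.card (AddCommGroup.primaryComponent Wd.sha 2)) ∧
    (2 * M₀ : ℤ) ≤ (padicValNat 2 (Nat.card (AddCommGroup.primaryComponent W.sha 2)) : ℤ) +
      (padicValNat 2 (Nat.card (AddCommGroup.primaryComponent Wd.sha 2)) : ℤ) +
      (padicValNat 2 Wd.tamagawaProduct : ℤ) := by
  obtain ⟨hne₁, hle₁⟩ :=
    relIndex_sha_comap_resBaseChange_le_two_pow_padicValNat_tamagawaProduct_twin_of_Δ_neg W K hΔ hIQ hodd hHe hT Cd hWd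
  obtain ⟨hne₂, hle₂⟩ := relIndex_sha_comap_resBaseChange_twin_le_two_pow W hΔ hIQ hodd hHe hT Cd hWd
  have h₁ := (padicValNat_natCard_le_of_le_comap_selmerGroup K W N Tp hTp hTpker hg hne₁ hle₁).2 hevp hB
  have h₂ := (padicValNat_natCard_le_of_le_comap_selmerGroup K Wd N' Tm hTm hTmker hg' hne₂ hle₂).2 hevm hB
  have h2 : 2 * M₀ ≤ padicValNat 2 (Nat.card (AddCommGroup.primaryComponent W.sha 2)) +
      padicValNat 2 (Nat.card (AddCommGroup.primaryComponent Wd.sha 2)) := by omega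
  refine ⟨h2, ?_⟩
  set a := padicValNat 2 (Nat.card (AddCommGroup.primaryComponent W.sha 2)) with ha
  set b := padicValNat 2 (Nat.card (AddCommGroup.primaryComponent Wd.sha 2)) with hb
  set B := padicValNat 2 Wd.tamagawaProduct with hBdef
  omega

end Assembly

end Summit.BirchSwinnertonDyer.BirchSwinnertonDyer.Theorems.GenusExact.PlusDescent

end
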